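import Literature.Analysis.OperatorTheory.Enflo2023.StepRealisationScale
import HarnessLib

/-!
# Enflo (2023), v2 (34) p.16 and p.19–20: the run-level independence hypothesis `IndepRunκ` in the MINIMAL MODEL
`T = τ·J`, `J = |e₁⟩⟨e₀|` on `ℂ²` — a kernel-checked calibration (it FAILS there, by a dynamical obstruction)

P. H. Enflo, *On the invariant subspace problem in Hilbert spaces*, arXiv:2305.15442v2 (2023) — a CLAIMED result
under adjudication; nothing in this file asserts the manuscript's theorem, and nothing here refutes it either: the
model operator below HAS invariant subspaces and is not "of type 1" (`T² = 0`), see the STATUS paragraph.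

WHAT IS CALIBRATED.  `StepRealisationScale` isolates the residual of Part B as the run-level hypothesis
`IndepRunκ T x₀ S ι σ β s₀` ((34) with each functional at its own scale, modulus `σ`, asked at every state reachable
from `s₀` by the Main Construction with ratio `β`, v2 p.19–20: "we can assume that for all `n`, `y_n` will be
`δ₂`-linearly independent"), and shows `PartBResidualIndepκ → ISP_separable`.  Generation 12 showed that the
state-level form `IndepBrκ` is NOT vacuous (unlike the uniform-modulus `IndepBr₂`), leaving open whether the
run-level form has content beyond the state-level one.  This file answers that in the smallest model in which the
objects of (34) are non-degenerate:
* `E = H = ℂ²` (`EuclideanSpace ℂ (Fin 2)`), coefficient contraction `S = J` (`J e₀ = e₁`, `J e₁ = 0`, the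
  truncated shift), operator `T = τ • J`, any `τ > 0` (the text's `‖T‖ = 10⁻²⁰` is `τ = 10⁻²⁰`), directions = the
  commutant `{J}' = {p·1 + r·J}` through `ιS J` — literally the tree's `State`, `Wn`, `IndepAtκ`, `IndepRunκ`,
  `exists_state_stepκ` instantiated, no new hypothesis objects.
* `Toy.indepRunκ_etheta_eq_zero`: for EVERY admissible start (`‖x₀‖ = 1`, `0 < σ ≤ 1`, `0 < β ≤ σ²/1000`, the start
  margin of `claimRun_of_indepRunκ`), `IndepRunκ (τ•J) x₀ J (ιS J) σ β s₀ → (εθ)₀ = 0`;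
* `Toy.exists_start` / `Toy.exists_start_at`: admissible starts with `0 < (εθ)₀ ≤ τ` exist as soon as
  `τ ≤ σ/250` — concretely `x₀ = (4/5, 3/5)` (`Toy.xSt`), `W = τ^{-1/2}·diag(1, τ)` (`Toy.WSt`, a `V_y`), bracket
  point `z = ((4/5)τ/(1+τ), (3/5)/(1+τ))` (`Toy.zSt`, `Toy.isBracket_start`), `(εθ)₀ = τ/(1+τ)²`; hence
  `Toy.not_indepRunκ`: the predicate is FALSE in the model;
* `Toy.start_necessary_condition` / `Toy.not_indepRunκ_at`: at that very start the STATE-LEVEL necessary condition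
  of gen 12 (the conclusion of `indepBrκ_self_le`) holds for every `μ ∈ ℂ` even with the best modulus `σ = 1`
  (`ℓ ∝ (4, 3)`, `κ(x₀ − z) ∝ (4, 3τ)`, `Toy.isBracket_side`), while `IndepRunκ` fails from it — the run-level
  content is strictly more than the state-level one;
* `Toy.not_type1`, `Toy.type2`, `Toy.hasNontrivialClosedInvariantSubspace` (§E'): the model operator is of the
  paper's type 2, not of type 1, and has non-trivial closed invariant subspaces — the kernel form of the STATUS caveat.
MECHANISM (the point of the calibration — it is DYNAMICAL, not the scale obstruction of `indepRun₂_etheta_eq_zero`):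
an intertwiner `V ∘ J = τJ ∘ V` is `V e₀ = a e₀ + b e₁`, `V e₁ = τ a e₁`; an admissible step `V ↦ c·V∘(1+N)`,
`‖N‖ ≤ 2β/σ`, replaces the tilt `η = b/a` by `η + τ r_N/(1+p_N)` (`Toy.step_eta`: `|Δη| ≤ 4τβ/σ` per step) while
`(εθ)` shrinks by the factor `1−β`; but at a true MC state (`‖z‖ ≥ 0.3`, `‖x₀ − z‖ ≥ 0.3`, `ℓ = W†z`, `x₀ − z = Wℓ`,
`‖ℓ‖² = (εθ)`) one has the STATE BOUND `0.09·τ ≤ (εθ)·(1 + (τ + |η|)²)` (`Toy.bracket_bound`).  Along the run the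
right side is `≤ (1−β)ⁿ(εθ)₀(1 + (τ + |η₀| + 4nτβ/σ)²) → 0`: the admissible directions cannot turn `y_n` fast enough
to keep `(εθ)_n → 0` compatible with the radius window.  The degenerate start `a = 0` fails at the first pivot by
`indepBrκ_self_le` (`Toy.not_indepBrκ_of_degenerate`: then `ℓ ∥ κ`).
DIMENSION-FREE HALF (`StepRealisation.direction_freeze`, in the paper's own `ℓ²`-model `V_y`, any Hilbert space):
for ANY operator `T`, `‖T‖ < 1`, and any step direction `N` on `ℓ²`, the new direction vector
`V_y((1+N)e₀) = (1 + (Ne₀)₀)·y + t` has `‖t‖ ≤ ‖T‖·‖y‖·(1 − ‖T‖²)^{-1/2}·‖N‖` — per admissible step the direction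
of `y_n` turns by `O(‖T‖·β/σ)` (`= O(10⁻²⁰β/σ)` in the text) while `(εθ)` drops by the factor `1 − β`.  What the
model adds is the RATE COMPARISON: at a true MC state with direction `u = y/‖y‖` the bracket structure bounds `(εθ)`
below by a modulus which in the model is `0.09τ/(1+(τ+|η|)²)` (`Toy.bracket_bound`) and vanishes exactly at the
non-cyclic direction `u ∥ e₁` (`|η| = ∞`) — reaching which is how the Main Construction is MEANT to end (Part A:
`y_n → y_∞` non-cyclic); `(εθ)_n = (1−β)ⁿ(εθ)₀` would need `|η_n| ≳ (1−β)^{-n/2}`, against `|η_n| ≤ |η₀| + 4nτβ/σ`.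
In infinite dimension (informal remark, not formalised): for a cyclic direction `u` the corresponding modulus is
positive but has no uniform lower bound and lives at the scale of the small eigenvalues of `V_uV_u† − |u⟩⟨u|`
(`≤ ‖T‖²/(1−‖T‖²)`), the same scale as the drift; so for an operator WITHOUT invariant subspaces nothing is derived
here and nothing is claimed — whether `IndepRunκ` can hold for such `T` is a quantitative near-cyclicity question
this file does not decide (deciding it for all `T` is ISP-hard).
STATUS / what this says about the text.  v2 p.19 l.655–662 derives the independence of the triple along the run from
"`T` is of type 1" (`|⟨T^{j₂}y_n, y_n⟩| ≥ δ₂‖y_n‖²` for some `j₂ > n₀`); the model `T = τJ` has `T² = 0`, is not of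
type 1 (`Toy.not_type1`; it is of type 2, `Toy.type2`), and has invariant subspaces
(`Toy.hasNontrivialClosedInvariantSubspace`), so the theorems below contradict NO assertion of the text as conditioned; nor is
the model an instance against the packaged residual `PartBResidualIndepκ`, which quantifies over INFINITE-dimensional
`H` and is a disjunction whose first disjunct (`HasNontrivialClosedInvariantSubspace T`) holds for `τJ`.  What they
show is about the PREDICATE `IndepRunκ` (typed in gen 11/12 WITHOUT a type-1 hypothesis, because the text's use of
type 1 at this point is a one-sentence assertion): (i) it has genuine run-level content — it is unsatisfiable in the
minimal model although its state-level necessary condition (`indepBrκ_self_le`) is met there, even with `σ = 1`, at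
the very start from which the run refutes it (`Toy.not_indepRunκ_at`; gen 12 showed the state-level form non-vacuous)
— and (ii) WHICH mechanism a derivation of (34)-along-the-run from "type 1 ∧ no invariant subspace" must overcome:
direction freezing of the admissible steps `y ↦ y + r(T)y` at rate `‖T‖·‖N‖` against the geometric decay of `(εθ)`.
The text (p.16–20) contains no estimate addressing the turning of `y_n`; the located gap of Part B (GAP.md, F2 gen
11–13) is unchanged and is now accompanied by a model exhibiting the mechanism.
No new axioms; zero `sorry`.

Origin: planner-b2b-enflo-2-g13-0 (Formaliser 2, generation 13), 2026-08-19.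
-/

noncomputable section

open scoped InnerProductSpace ComplexConjugate
open ContinuousLinearMap Filter Topology

namespace Literature.Analysis.OperatorTheory.Enflo2023

namespace StepRealisation

open MCStep

namespace Toy

/-! ### A. The model space `ℂ²`, the truncated shift `J`, the operator `T = τ•J` -/

/-- `ℂ²` as a Hilbert space. [folklore] -/
abbrev C2 : Type := EuclideanSpace ℂ (Fin 2)

/-- the first basis vector. [folklore] -/
def e0 : C2 := EuclideanSpace.single 0 1

/-- the second basis vector. [folklore] -/
def e1 : C2 := EuclideanSpace.single 1 1

/-- `(e₀)₀ = 1`. [folklore] -/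
@[simp] lemma e0_zero : e0 0 = 1 := by simp [e0]
/-- `(e₀)₁ = 0`. [folklore] -/
@[simp] lemma e0_one : e0 1 = 0 := by simp [e0]
/-- `(e₁)₀ = 0`. [folklore] -/
@[simp] lemma e1_zero : e1 0 = 0 := by simp [e1]
/-- `(e₁)₁ = 1`. [folklore] -/
@[simp] lemma e1_one : e1 1 = 1 := by simp [e1]

/-- coordinates. [folklore] -/
lemma decomp (v : C2) : v = v 0 • e0 + v 1 • e1 := by
  ext i
  fin_cases i <;> simp

/-- `⟪e₀, v⟫ = v₀`. [folklore] -/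
@[simp] lemma inner_e0_left (v : C2) : ⟪e0, v⟫_ℂ = v 0 := by
  rw [e0, EuclideanSpace.inner_single_left]; simp

/-- `⟪e₁, v⟫ = v₁`. [folklore] -/
@[simp] lemma inner_e1_left (v : C2) : ⟪e1, v⟫_ℂ = v 1 := by
  rw [e1, EuclideanSpace.inner_single_left]; simp

/-- `‖v‖² = |v₀|² + |v₁|²`. [folklore] -/
lemma norm_sq (v : C2) : ‖v‖ ^ 2 = ‖v 0‖ ^ 2 + ‖v 1‖ ^ 2 := by
  rw [EuclideanSpace.norm_sq_eq, Fin.sum_univ_two]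

/-- `|v₀| ≤ ‖v‖`. [folklore] -/
lemma norm_zero_le (v : C2) : ‖v 0‖ ≤ ‖v‖ := by
  have h := norm_sq v
  nlinarith [norm_nonneg (v 0), norm_nonneg (v 1), norm_nonneg v]

/-- `|v₁| ≤ ‖v‖`. [folklore] -/
lemma norm_one_le (v : C2) : ‖v 1‖ ≤ ‖v‖ := by
  have h := norm_sq v
  nlinarith [norm_nonneg (v 0), norm_nonneg (v 1), norm_nonneg v]

/-- `‖e₀‖ = 1`. [folklore] -/
@[simp] lemma norm_e0 : ‖e0‖ = 1 := by simp [e0]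
/-- `‖e₁‖ = 1`. [folklore] -/
@[simp] lemma norm_e1 : ‖e1‖ = 1 := by simp [e1]

/-- The truncated shift `J = |e₁⟩⟨e₀|`: `J v = v₀ e₁` (`J e₀ = e₁`, `J e₁ = 0`, `J² = 0`) — the coefficient
contraction `S` of the model (the right shift of `ℓ²` cut to two coordinates). [cite: Enflo2023, v2 (2)–(4) p.2; (9) p.4] -/
def J : C2 →L[ℂ] C2 := (EuclideanSpace.proj (0 : Fin 2) : C2 →L[ℂ] ℂ).smulRight e1

/-- `J v = v₀ e₁`. [folklore] -/
lemma J_apply (v : C2) : J v = v 0 • e1 := by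
  simp [J]

/-- `(J v)₀ = 0`. [folklore] -/
@[simp] lemma J_apply_zero (v : C2) : (J v) 0 = 0 := by simp [J_apply]
/-- `(J v)₁ = v₀`. [folklore] -/
@[simp] lemma J_apply_one (v : C2) : (J v) 1 = v 0 := by simp [J_apply]

/-- `J e₀ = e₁`. [folklore] -/
@[simp] lemma J_e0 : J e0 = e1 := by rw [J_apply, e0_zero, one_smul]
/-- `J e₁ = 0` (`J² = 0`). [folklore] -/
@[simp] lemma J_e1 : J e1 = 0 := by rw [J_apply, e1_zero, zero_smul]

/-- `‖J v‖ = |v₀|`. [folklore] -/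
lemma norm_J_apply (v : C2) : ‖J v‖ = ‖v 0‖ := by
  rw [J_apply, norm_smul, norm_e1, mul_one]

/-- `J` is a contraction. [folklore] -/
lemma norm_J_le : ‖J‖ ≤ 1 :=
  opNorm_le_bound _ zero_le_one fun v => by rw [norm_J_apply, one_mul]; exact norm_zero_le v

/-- The model operator `T = τ•J` (`‖T‖ = τ`, `T² = 0`; the text's `‖T‖_op = 10⁻²⁰` is `τ = 10⁻²⁰`).
[cite: Enflo2023, v2 p.12 (‖T‖_op = 10⁻²⁰)] -/
def Tτ (τ : ℝ) : C2 →L[ℂ] C2 := (τ : ℂ) • J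

/-- `T_τ v = τ • J v`. [folklore] -/
lemma Tτ_apply (τ : ℝ) (v : C2) : Tτ τ v = (τ : ℂ) • J v := rfl

/-! ### B. Intertwiners `W ∘ J = τJ ∘ W` in coordinates: `W e₀ = A e₀ + B e₁`, `W e₁ = τA e₁` -/

section Intertwiner

variable {τ : ℝ} {W : C2 →L[ℂ] C2}

/-- coordinates of `W v` from those of `W e₀`, `W e₁`. [folklore] -/
lemma apply_coord (W : C2 →L[ℂ] C2) (v : C2) (i : Fin 2) :
    (W v) i = v 0 * (W e0) i + v 1 * (W e1) i := by
  conv_lhs => rw [decomp v]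
  simp [map_add, map_smul]

/-- coordinates of the adjoint: `(W†u)ᵢ = ⟪W eᵢ, u⟫`. [folklore] -/
lemma adjoint_coord_zero (W : C2 →L[ℂ] C2) (u : C2) : (adjoint W u) 0 = ⟪W e0, u⟫_ℂ := by
  rw [← inner_e0_left, adjoint_inner_right]

/-- `(W† u)₁ = ⟪W e₁, u⟫`. [folklore] -/
lemma adjoint_coord_one (W : C2 →L[ℂ] C2) (u : C2) : (adjoint W u) 1 = ⟪W e1, u⟫_ℂ := by
  rw [← inner_e1_left, adjoint_inner_right]

/-- `⟪w, u⟫` in coordinates. [folklore] -/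
lemma inner_coord (w u : C2) : ⟪w, u⟫_ℂ = conj (w 0) * u 0 + conj (w 1) * u 1 := by
  conv_lhs => rw [decomp w]
  rw [inner_add_left, inner_smul_left, inner_smul_left, inner_e0_left, inner_e1_left]

variable (hW : ∀ b, W (J b) = (τ : ℂ) • J (W b))
include hW

/-- `W e₁ = τ J (W e₀)`: `(W e₁)₀ = 0`. [folklore] -/
lemma e1_coord_zero : (W e1) 0 = 0 := by
  rw [← J_e0, hW]; simp

/-- `(W e₁)₁ = τ (W e₀)₀`. [folklore] -/
lemma e1_coord_one : (W e1) 1 = τ * (W e0) 0 := by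
  rw [← J_e0, hW]; simp

/-- `(W v)₀ = v₀ A`. [folklore] -/
lemma apply_zero (v : C2) : (W v) 0 = v 0 * (W e0) 0 := by
  rw [apply_coord, e1_coord_zero hW, mul_zero, add_zero]

/-- `(W v)₁ = v₀ B + v₁ τ A`. [folklore] -/
lemma apply_one (v : C2) : (W v) 1 = v 0 * (W e0) 1 + v 1 * (τ * (W e0) 0) := by
  rw [apply_coord, e1_coord_one hW]

omit hW in
/-- `(W†u)₀ = conj A · u₀ + conj B · u₁`. [folklore] -/
lemma adjoint_zero (u : C2) : (adjoint W u) 0 = conj ((W e0) 0) * u 0 + conj ((W e0) 1) * u 1 := by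
  rw [adjoint_coord_zero, inner_coord]

/-- `(W†u)₁ = τ · conj A · u₁`. [folklore] -/
lemma adjoint_one (u : C2) : (adjoint W u) 1 = τ * conj ((W e0) 0) * u 1 := by
  rw [adjoint_coord_one, inner_coord, e1_coord_zero hW, e1_coord_one hW, map_zero, zero_mul, zero_add,
    map_mul, Complex.conj_ofReal]

end Intertwiner

/-! ### C. The state bound `0.09·τ ≤ (εθ)(1 + (τ + |η|)²)` and the step recursion `η ↦ η + τ r/(1+p)` -/

/-- **THE STATE BOUND.**  At a bracket point `z` (`z + WW†z = x₀`) of an intertwiner `W` with tilt `η`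
(`(W e₀)₁ = η (W e₀)₀`), inside the Part-B window `‖z‖ ≥ 0.3`, `‖x₀ − z‖ ≥ 0.3`:
`0.09·τ ≤ ‖W†z‖²·(1 + (τ + |η|)²)` — and `‖W†z‖² = (εθ)` ((16)).  Proof: `ℓ = W†z` has `|ℓ₁| = τ|A||z₁|`,
`|A||z₀| ≤ |ℓ₀| + |η||A||z₁|`, so `0.09τ²|A|² ≤ ‖ℓ‖²(1+(τ+|η|)²)`; and `x₀ − z = Wℓ` gives
`0.09 ≤ |A|²‖ℓ‖²(1+(τ+|η|)²)`; multiply. [cite: Enflo2023, v2 (13)–(16) p.6; (32) p.15] -/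
theorem bracket_bound {τ : ℝ} (hτ : 0 < τ) {W : C2 →L[ℂ] C2} (hW : ∀ b, W (J b) = (τ : ℂ) • J (W b))
    {η : ℂ} (hη : (W e0) 1 = η * (W e0) 0) {x₀ z : C2} (hz : IsBracket W x₀ z)
    (hz3 : (0.3 : ℝ) ≤ ‖z‖) (hxz : (0.3 : ℝ) ≤ ‖x₀ - z‖) :
    0.09 * τ ≤ ‖adjoint W z‖ ^ 2 * (1 + (τ + ‖η‖) ^ 2) := by
  set A : ℂ := (W e0) 0 with hA
  set ℓ : C2 := adjoint W z with hℓ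
  have hB : ‖(W e0) 1‖ = ‖η‖ * ‖A‖ := by rw [hη, norm_mul]
  have hτn : ‖(τ : ℂ)‖ = τ := Complex.norm_of_nonneg hτ.le
  have l0 : ‖ℓ 0‖ ≤ ‖ℓ‖ := norm_zero_le ℓ
  have l1 : ‖ℓ 1‖ ≤ ‖ℓ‖ := norm_one_le ℓ
  -- (f1) |ℓ₁| = τ|A||z₁|
  have f1 : ‖ℓ 1‖ = τ * ‖A‖ * ‖z 1‖ := by
    rw [hℓ, adjoint_one hW z, norm_mul, norm_mul, hτn, Complex.norm_conj]
  -- (f2) |A||z₀| ≤ |ℓ₀| + |η||A||z₁|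
  have f2 : ‖A‖ * ‖z 0‖ ≤ ‖ℓ 0‖ + ‖η‖ * ‖A‖ * ‖z 1‖ := by
    have e : conj A * z 0 = ℓ 0 - conj ((W e0) 1) * z 1 := by
      rw [hℓ, adjoint_zero (W := W) z]; ring
    have h := norm_sub_le (ℓ 0) (conj ((W e0) 1) * z 1)
    rw [← e, norm_mul, Complex.norm_conj, norm_mul, Complex.norm_conj, hB] at h
    linarith
  -- (I) 0.09 τ²|A|² ≤ ‖ℓ‖²(1+(τ+|η|)²)
  have g1 : τ * ‖A‖ * ‖z 1‖ ≤ ‖ℓ‖ := by rw [← f1]; exact l1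
  have g0 : τ * ‖A‖ * ‖z 0‖ ≤ ‖ℓ‖ * (τ + ‖η‖) := by
    have h1 := mul_le_mul_of_nonneg_left f2 hτ.le
    have h2 := mul_le_mul_of_nonneg_left g1 (norm_nonneg η)
    have h3 := mul_le_mul_of_nonneg_left l0 hτ.le
    linarith [h1, h2, h3]
  have hz2 : (0.09 : ℝ) ≤ ‖z 0‖ ^ 2 + ‖z 1‖ ^ 2 := by rw [← norm_sq]; nlinarith [norm_nonneg z]
  have hI : 0.09 * (τ ^ 2 * ‖A‖ ^ 2) ≤ ‖ℓ‖ ^ 2 * (1 + (τ + ‖η‖) ^ 2) := by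
    have s0 : (τ * ‖A‖ * ‖z 0‖) ^ 2 ≤ (‖ℓ‖ * (τ + ‖η‖)) ^ 2 :=
      pow_le_pow_left₀ (by positivity) g0 2
    have s1 : (τ * ‖A‖ * ‖z 1‖) ^ 2 ≤ ‖ℓ‖ ^ 2 := by
      have := pow_le_pow_left₀ (by positivity) g1 2
      linarith [this]
    have s2 := mul_le_mul_of_nonneg_left hz2 (by positivity : (0 : ℝ) ≤ τ ^ 2 * ‖A‖ ^ 2)
    have e0 : (τ * ‖A‖ * ‖z 0‖) ^ 2 = τ ^ 2 * ‖A‖ ^ 2 * ‖z 0‖ ^ 2 := by ring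
    have e1 : (τ * ‖A‖ * ‖z 1‖) ^ 2 = τ ^ 2 * ‖A‖ ^ 2 * ‖z 1‖ ^ 2 := by ring
    have e2 : (‖ℓ‖ * (τ + ‖η‖)) ^ 2 = ‖ℓ‖ ^ 2 * (τ + ‖η‖) ^ 2 := by ring
    rw [e0, e2] at s0
    rw [e1] at s1
    rw [mul_add] at s2
    linarith [s0, s1, s2]
  -- (II) 0.09 ≤ |A|²‖ℓ‖²(1+(τ+|η|)²)
  have hxz' : x₀ - z = W ℓ := by
    have h : z + W (adjoint W z) = x₀ := hz
    rw [← h, hℓ]; abel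
  have hII : (0.09 : ℝ) ≤ ‖A‖ ^ 2 * (‖ℓ‖ ^ 2 * (1 + (τ + ‖η‖) ^ 2)) := by
    have w0 : ‖(W ℓ) 0‖ ≤ ‖ℓ‖ * ‖A‖ := by
      rw [apply_zero hW ℓ, norm_mul]; exact mul_le_mul_of_nonneg_right l0 (norm_nonneg _)
    have w1 : ‖(W ℓ) 1‖ ≤ ‖ℓ‖ * ‖A‖ * (τ + ‖η‖) := by
      rw [apply_one hW ℓ]
      have h := norm_add_le (ℓ 0 * (W e0) 1) (ℓ 1 * ((τ : ℂ) * (W e0) 0))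
      rw [norm_mul, norm_mul, norm_mul, hB, hτn] at h
      have h1 := mul_le_mul_of_nonneg_right l0 (by positivity : (0 : ℝ) ≤ ‖η‖ * ‖A‖)
      have h2 := mul_le_mul_of_nonneg_right l1 (by positivity : (0 : ℝ) ≤ τ * ‖A‖)
      have e : ‖ℓ‖ * ‖A‖ * (τ + ‖η‖) = ‖ℓ‖ * (‖η‖ * ‖A‖) + ‖ℓ‖ * (τ * ‖A‖) := by ring
      rw [e]
      linarith [h, h1, h2]
    have hx2 : (0.09 : ℝ) ≤ ‖(W ℓ) 0‖ ^ 2 + ‖(W ℓ) 1‖ ^ 2 := by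
      rw [← norm_sq, ← hxz']; nlinarith [norm_nonneg (x₀ - z)]
    have s0 := pow_le_pow_left₀ (norm_nonneg _) w0 2
    have s1 := pow_le_pow_left₀ (norm_nonneg _) w1 2
    have e0 : (‖ℓ‖ * ‖A‖) ^ 2 = ‖A‖ ^ 2 * ‖ℓ‖ ^ 2 := by ring
    have e1 : (‖ℓ‖ * ‖A‖ * (τ + ‖η‖)) ^ 2 = ‖A‖ ^ 2 * (‖ℓ‖ ^ 2 * (τ + ‖η‖) ^ 2) := by ring
    rw [e0] at s0
    rw [e1] at s1
    have e2 : ‖A‖ ^ 2 * (‖ℓ‖ ^ 2 * (1 + (τ + ‖η‖) ^ 2)) =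
        ‖A‖ ^ 2 * ‖ℓ‖ ^ 2 + ‖A‖ ^ 2 * (‖ℓ‖ ^ 2 * (τ + ‖η‖) ^ 2) := by ring
    rw [e2]
    linarith [s0, s1, hx2]
  -- combine: 0.09·0.09τ² ≤ 0.09τ²|A|²X ≤ X², so X ≥ 0.09τ
  set X : ℝ := ‖ℓ‖ ^ 2 * (1 + (τ + ‖η‖) ^ 2) with hX
  have hX0 : 0 ≤ X := by positivity
  by_contra hlt
  have hlt' : X < 0.09 * τ := lt_of_not_ge hlt
  have h1 : 0.09 * (τ ^ 2 * ‖A‖ ^ 2) * X ≤ X * X := mul_le_mul_of_nonneg_right hI hX0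
  have h2 : 0.09 * τ ^ 2 * 0.09 ≤ 0.09 * τ ^ 2 * (‖A‖ ^ 2 * X) :=
    mul_le_mul_of_nonneg_left hII (by positivity)
  have h3 : X * X < (0.09 * τ) * (0.09 * τ) := mul_self_lt_mul_self hX0 hlt'
  have e1 : 0.09 * (τ ^ 2 * ‖A‖ ^ 2) * X = 0.09 * τ ^ 2 * (‖A‖ ^ 2 * X) := by ring
  have e2 : (0.09 * τ) * (0.09 * τ) = 0.09 * τ ^ 2 * 0.09 := by ring
  rw [e1] at h1
  rw [e2] at h3
  linarith [h1, h2, h3]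

/-- **THE STEP RECURSION.**  If `W` intertwines with tilt `η` and `‖N‖ ≤ ν ≤ 1/2`, then `W ∘ (1+N)` has a tilt
`η'` with `|η'| ≤ |η| + 2τν`: indeed `η' = η + τ r/(1+p)`, `p = (Ne₀)₀`, `r = (Ne₀)₁` — the admissible
directions turn `y` only through `T = τJ`. [cite: Enflo2023, v2 p.16 ("`T^j(y' + r(T)y')`"), (41)–(44) p.18] -/
theorem step_eta {τ : ℝ} (hτ : 0 ≤ τ) {W : C2 →L[ℂ] C2} (hW : ∀ b, W (J b) = (τ : ℂ) • J (W b))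
    {η : ℂ} (hη : (W e0) 1 = η * (W e0) 0) (N : C2 →L[ℂ] C2) {ν : ℝ} (hN : ‖N‖ ≤ ν) (hν : ν ≤ 1 / 2) :
    ∃ η' : ℂ, ((W ∘L (1 + N)) e0) 1 = η' * ((W ∘L (1 + N)) e0) 0 ∧ ‖η'‖ ≤ ‖η‖ + 2 * τ * ν := by
  set p : ℂ := (N e0) 0 with hp
  set r : ℂ := (N e0) 1 with hr
  have hNe : ‖N e0‖ ≤ ν := (N.le_opNorm e0).trans (by rw [norm_e0, mul_one]; exact hN)
  have hpn : ‖p‖ ≤ ν := (norm_zero_le _).trans hNe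
  have hrn : ‖r‖ ≤ ν := (norm_one_le _).trans hNe
  have h1p : (1 : ℝ) / 2 ≤ ‖1 + p‖ := by
    have h := norm_sub_le (1 + p) p
    rw [add_sub_cancel_right, norm_one] at h
    linarith
  have h1p0 : (1 : ℂ) + p ≠ 0 := fun h => by rw [h, norm_zero] at h1p; linarith
  have c0 : ((W ∘L (1 + N)) e0) 0 = (1 + p) * (W e0) 0 := by
    rw [comp_apply, add_apply, one_apply_eq_self, map_add, PiLp.add_apply,
      apply_zero hW (N e0)]; ring
  have c1 : ((W ∘L (1 + N)) e0) 1 = (1 + p) * (W e0) 1 + r * ((τ : ℂ) * (W e0) 0) := by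
    rw [comp_apply, add_apply, one_apply_eq_self, map_add, PiLp.add_apply,
      apply_one hW (N e0)]; ring
  refine ⟨η + (τ : ℂ) * r / (1 + p), ?_, ?_⟩
  · rw [c0, c1, hη]
    field_simp
  · have hd : ‖(τ : ℂ) * r / (1 + p)‖ ≤ 2 * τ * ν := by
      rw [norm_div, norm_mul, Complex.norm_of_nonneg hτ, div_le_iff₀ (by linarith)]
      have h1 := mul_le_mul_of_nonneg_left hrn hτ
      have h2 : τ * ν ≤ 2 * τ * ν * ‖1 + p‖ := by nlinarith [mul_nonneg hτ (le_trans (norm_nonneg _) hrn)]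
      linarith
    exact (norm_add_le _ _).trans (by linarith)

/-! ### D. The degenerate start, and the run -/

/-- **Degenerate case.**  If `W e₁ = 0` (tilt `a = 0`: `W = b|e₁⟩⟨e₀|`), then `range W† ⊆ ℂe₀`, so `ℓ ∥ κ(x₀ − z)`
and `indepBrκ_self_le` forces `ℓ = 0`: the intrinsic independence fails at the self-pivot. [cite: Enflo2023, v2 (34)–(38) p.16–17] -/
theorem not_indepBrκ_of_degenerate {W : C2 →L[ℂ] C2} (hW1 : W e1 = 0) (x₀ : C2) {σ : ℝ} (hσ : 0 < σ) :
    ¬ IndepBrκ W x₀ (x₀ - bz W x₀) (ιS J) σ := by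
  intro h
  obtain ⟨hA, hκ⟩ := h.ne_zero
  have key : ∀ u : C2, (adjoint W u) 1 = 0 := fun u => by
    rw [adjoint_coord_one, hW1, inner_zero_left]
  have hℓ1 : (ba W x₀) 1 = 0 := key _
  have hκ1 : (bκ W (x₀ - bz W x₀)) 1 = 0 := key _
  have hκ0 : (bκ W (x₀ - bz W x₀)) 0 ≠ 0 := by
    intro h0
    apply hκ
    ext i
    fin_cases i
    · simpa using h0
    · simpa using hκ1
  have hι1 : ∀ p : Comm J, ‖ιS J p‖ ≤ ‖p‖ := (ιS_props J).2.1
  have hle := indepBrκ_self_le W x₀ (ιS J) hσ hι1 h ((ba W x₀) 0 / (bκ W (x₀ - bz W x₀)) 0)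
  have hzero : ba W x₀ - ((ba W x₀) 0 / (bκ W (x₀ - bz W x₀)) 0) • bκ W (x₀ - bz W x₀) = 0 := by
    ext i
    fin_cases i
    · simp [div_mul_cancel₀ _ hκ0]
    · simp [hℓ1, hκ1]
  rw [hzero, norm_zero, mul_zero] at hle
  have h0 : ‖ba W x₀‖ ≤ 0 := by
    by_contra hpos
    linarith [mul_pos hσ (lt_of_not_ge hpos)]
  exact hA (norm_le_zero_iff.1 h0)

/-- arithmetic of the endgame: `rⁿ·E·(1 + (D + nδ)²) → 0`. [folklore] -/
lemma exists_geometric_lt {r E D δ c : ℝ} (hr0 : 0 ≤ r) (hr1 : r < 1) (hE : 0 ≤ E) (hD : 0 ≤ D)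
    (hδ : 0 ≤ δ) (hc : 0 < c) : ∃ n : ℕ, r ^ n * E * (1 + (D + n * δ) ^ 2) < c := by
  have ht := tendsto_pow_const_mul_const_pow_of_abs_lt_one 2 (abs_lt.2 ⟨by linarith, hr1⟩)
  set Kc : ℝ := E * (1 + (D + δ) ^ 2) with hKc
  have hKc0 : 0 ≤ Kc := by positivity
  have hε : 0 < c / (Kc + 1) := by positivity
  obtain ⟨N, hN⟩ := eventually_atTop.1 (ht.eventually_lt_const hε)
  refine ⟨max N 1, ?_⟩
  have hn1 : (1 : ℝ) ≤ (max N 1 : ℕ) := by exact_mod_cast le_max_right N 1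
  have hNn : ((max N 1 : ℕ) : ℝ) ^ 2 * r ^ (max N 1) < c / (Kc + 1) := hN _ (le_max_left _ _)
  set m : ℕ := max N 1
  have h1 : 1 + (D + m * δ) ^ 2 ≤ (1 + (D + δ) ^ 2) * (m : ℝ) ^ 2 := by
    have h4 : D ≤ D * m := le_mul_of_one_le_right hD hn1
    have h3 : D + m * δ ≤ (D + δ) * m := by linarith
    have h2 : (D + m * δ) ^ 2 ≤ ((D + δ) * m) ^ 2 := pow_le_pow_left₀ (by positivity) h3 2
    have hm2 : (1 : ℝ) ≤ (m : ℝ) ^ 2 := one_le_pow₀ hn1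
    have e : (1 + (D + δ) ^ 2) * (m : ℝ) ^ 2 = (m : ℝ) ^ 2 + ((D + δ) * m) ^ 2 := by ring
    rw [e]
    linarith
  have hpos : 0 ≤ (m : ℝ) ^ 2 * r ^ m := by positivity
  calc r ^ m * E * (1 + (D + m * δ) ^ 2) ≤ r ^ m * E * ((1 + (D + δ) ^ 2) * (m : ℝ) ^ 2) :=
        mul_le_mul_of_nonneg_left h1 (by positivity)
    _ = Kc * ((m : ℝ) ^ 2 * r ^ m) := by rw [hKc]; ring
    _ ≤ (Kc + 1) * ((m : ℝ) ^ 2 * r ^ m) := by nlinarith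
    _ < (Kc + 1) * (c / (Kc + 1)) := mul_lt_mul_of_pos_left hNn (by positivity)
    _ = c := mul_div_cancel₀ _ (by positivity)

variable {τ : ℝ} {x₀ : C2}

/-- every state's `V` intertwines: `V (J b) = τ J (V b)`. [cite: Enflo2023, v2 (2)–(4) p.2] -/
lemma state_intertwine (s : State (Tτ τ) x₀ J) (b : C2) : s.V (J b) = (τ : ℂ) • J (s.V b) := by
  rw [s.hVS]; rfl

/-- … and so does its normalised operator `Wn s`. [cite: Enflo2023, v2 (5)–(6) p.3] -/
lemma Wn_intertwine (s : State (Tτ τ) x₀ J) (b : C2) : Wn s (J b) = (τ : ℂ) • J (Wn s b) := by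
  rw [Wn, smul_apply, smul_apply, state_intertwine, map_smul, smul_comm]

/-- the tilt of `Wn s` is the tilt of `s.V`. [folklore] -/
lemma Wn_tilt (s : State (Tτ τ) x₀ J) {η : ℂ} (hη : (s.V e0) 1 = η * (s.V e0) 0) :
    (Wn s e0) 1 = η * (Wn s e0) 0 := by
  rw [Wn, smul_apply, PiLp.smul_apply, PiLp.smul_apply, smul_eq_mul, smul_eq_mul, hη]; ring

/-- **THE RUN-LEVEL HYPOTHESIS FAILS IN THE MODEL (quantitative form): `IndepRunκ (τ•J) x₀ J (ιS J) σ β s₀`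
forces `(εθ)₀ = 0`.**  Every reachable state is its own pivot, so `IndepAtκ` holds along the run built by
`exists_state_stepκ` itself; along it `(εθ)_n = (1−β)ⁿ(εθ)₀`, the tilt obeys `|η_n| ≤ |η₀| + 4nτβ/σ`
(`step_eta`), and `bracket_bound` gives `0.09τ ≤ (1−β)ⁿ(εθ)₀(1 + (τ + |η₀| + 4nτβ/σ)²) → 0` — absurd.  A
degenerate start dies at once (`not_indepBrκ_of_degenerate`). [cite: Enflo2023, v2 (34) p.16; (45)–(46) p.19; p.19–20] -/
theorem indepRunκ_etheta_eq_zero (hτ : 0 < τ) (hx₀ : ‖x₀‖ = 1) {σ β : ℝ} (hσ : 0 < σ) (hσ1 : σ ≤ 1)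
    (hβ0 : 0 < β) (hβ : β ≤ σ ^ 2 / 1000) (s₀ : State (Tτ τ) x₀ J)
    (hstart : (0.09 : ℝ) + (22 / σ + 1) * s₀.etheta ≤ s₀.ε ^ 2 ∧
      s₀.ε ^ 2 + (22 / σ + 1) * s₀.etheta ≤ 0.49)
    (h : IndepRunκ (Tτ τ) x₀ J (ιS J) σ β s₀) : s₀.etheta = 0 := by
  obtain ⟨hιs, hι1, hιS⟩ := ιS_props J
  have hS : ‖J‖ ≤ 1 := norm_J_le
  have hσ2 : σ ^ 2 ≤ σ := by nlinarith
  have hβ1 : β < 1 := by linarith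
  have hν : 2 * β / σ ≤ 1 / 2 := by
    rw [div_le_iff₀ hσ]; linarith
  have hR0 : RadInv σ s₀ s₀ := by
    show |s₀.ε ^ 2 - s₀.ε ^ 2| ≤ (22 / σ + 1) * (s₀.etheta - s₀.etheta)
    rw [sub_self, abs_zero, sub_self, mul_zero]
  have hself : ∀ s : State (Tτ τ) x₀ J, InvP (22 / σ) s (x₀ - s.v) s := by
    intro s
    refine ⟨le_rfl, ?_, ?_⟩
    · rw [sub_self, inner_zero_right]
    · rw [sub_self, inner_zero_right, map_zero, abs_zero, sub_self, mul_zero]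
  by_contra hne
  have he0 : 0 < s₀.etheta := lt_of_le_of_ne (s₀.etheta_nonneg hx₀ hS) (Ne.symm hne)
  by_cases hdeg : (s₀.V e0) 0 = 0
  · -- degenerate start: `W e₁ = 0`, independence fails at the first pivot
    have hV1 : s₀.V e1 = 0 := by
      rw [← J_e0, state_intertwine, J_apply, hdeg, zero_smul, smul_zero]
    have hW1 : Wn s₀ e1 = 0 := by rw [Wn, smul_apply, hV1, smul_zero]
    have hind : IndepAtκ (ιS J) σ s₀ (x₀ - s₀.v) := h s₀ s₀ ReachN.start ReachN.start (hself s₀) he0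
    have hbr : IsBracket (Wn s₀) x₀ s₀.v := isBracket_Wn hx₀ s₀ he0
    have hvz : s₀.v = bz (Wn s₀) x₀ := hbr.unique (isBracket_bz (Wn s₀) x₀)
    have hind' : IndepBrκ (Wn s₀) x₀ (x₀ - bz (Wn s₀) x₀) (ιS J) σ := by
      have h' : IndepBrκ (Wn s₀) x₀ (x₀ - s₀.v) (ιS J) σ := hind
      rw [hvz] at h'
      exact h'
    exact not_indepBrκ_of_degenerate hW1 x₀ hσ hind'
  · -- non-degenerate start: the tilt recursion
    set η₀ : ℂ := (s₀.V e0) 1 / (s₀.V e0) 0 with hη₀d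
    have hη₀ : (s₀.V e0) 1 = η₀ * (s₀.V e0) 0 := by rw [hη₀d, div_mul_cancel₀ _ hdeg]
    set δ : ℝ := 2 * τ * (2 * β / σ) with hδ
    have hδ0 : 0 ≤ δ := by positivity
    set K : ℝ := 22 / σ + 1 with hK
    have hK0 : 0 ≤ K := by positivity
    have iter : ∀ n : ℕ, ∃ s : State (Tτ τ) x₀ J, ReachN (22 / σ) β (RadInv σ s₀) s₀ s ∧
        s.etheta = (1 - β) ^ n * s₀.etheta ∧
        ∃ η : ℂ, (s.V e0) 1 = η * (s.V e0) 0 ∧ ‖η‖ ≤ ‖η₀‖ + n * δ := by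
      intro n
      induction n with
      | zero => exact ⟨s₀, ReachN.start, by rw [pow_zero, one_mul], η₀, hη₀, by simp⟩
      | succ n ih =>
        obtain ⟨s, hs, hes, η, hη, hηn⟩ := ih
        have he : 0 < s.etheta := by rw [hes]; exact mul_pos (pow_pos (by linarith) _) he0
        have hRs : |s.ε ^ 2 - s₀.ε ^ 2| ≤ K * (s₀.etheta - s.etheta) := hs.inv hR0
        have hβe : K * β * s.etheta ≤ K * s.etheta := by
          have h1 : β * s.etheta ≤ s.etheta := mul_le_of_le_one_left he.le hβ1.le
          have h2 := mul_le_mul_of_nonneg_left h1 hK0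
          linarith [h2]
        have hab := abs_le.1 hRs
        have hlo : (0.09 : ℝ) + (22 / σ + 1) * β * s.etheta ≤ s.ε ^ 2 := by
          rw [← hK]; linarith [hab.1, hstart.1]
        have hhi : s.ε ^ 2 + (22 / σ + 1) * β * s.etheta ≤ 0.49 := by
          rw [← hK]; linarith [hab.2, hstart.2]
        obtain ⟨s', h1, -, h3, h4, p, hp, hV'⟩ := exists_state_stepκ hιs hι1 hιS hx₀ s he hσ hσ1 hβ0.le
          hβ (x₀ - s.v) (h s s hs hs (hself s) he) hlo hhi
        have hN : ‖ιS J p‖ ≤ 2 * β / σ := (hι1 p).trans hp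
        obtain ⟨η', hη', hη'n⟩ := step_eta hτ.le (Wn_intertwine s) (Wn_tilt s hη) (ιS J p) hN hν
        refine ⟨s', ReachN.step hs ?_ h1.le ?_, by rw [h1, hes, pow_succ]; ring, η', by rw [hV']; exact hη',
          ?_⟩
        · show |s'.ε ^ 2 - s₀.ε ^ 2| ≤ (22 / σ + 1) * (s₀.etheta - s'.etheta)
          rw [← hK] at h4 ⊢
          calc |s'.ε ^ 2 - s₀.ε ^ 2| ≤ |s'.ε ^ 2 - s.ε ^ 2| + |s.ε ^ 2 - s₀.ε ^ 2| := abs_sub_le _ _ _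
            _ ≤ K * β * s.etheta + K * (s₀.etheta - s.etheta) := add_le_add h4 hRs
            _ = K * (s₀.etheta - s'.etheta) := by rw [h1]; ring
        · rw [RCLike.re_to_complex]; exact h3
        · push_cast
          linarith [hη'n, hηn]
    -- the state bound along the run
    have hbound : ∀ n : ℕ, 0.09 * τ ≤ (1 - β) ^ n * s₀.etheta * (1 + (τ + ‖η₀‖ + n * δ) ^ 2) := by
      intro n
      obtain ⟨s, hs, hes, η, hη, hηn⟩ := iter n
      have he : 0 < s.etheta := by rw [hes]; exact mul_pos (pow_pos (by linarith) _) he0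
      have hbr : IsBracket (Wn s) x₀ s.v := isBracket_Wn hx₀ s he
      have hes' : ‖adjoint (Wn s) s.v‖ ^ 2 = s.etheta := by rw [etheta_eq_eth, eth_eq_of_isBracket hbr]
      have hb := bracket_bound hτ (Wn_intertwine s) (Wn_tilt s hη) hbr (s.window hx₀).1
        (norm_x₀_sub_v_ge hx₀ s)
      rw [hes', hes] at hb
      have hmono : 1 + (τ + ‖η‖) ^ 2 ≤ 1 + (τ + ‖η₀‖ + n * δ) ^ 2 := by
        have h1 : τ + ‖η‖ ≤ τ + ‖η₀‖ + n * δ := by linarith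
        have h2 := pow_le_pow_left₀ (by positivity) h1 2
        linarith
      exact hb.trans (mul_le_mul_of_nonneg_left hmono (mul_nonneg (pow_nonneg (by linarith) _) he0.le))
    obtain ⟨n, hn⟩ := exists_geometric_lt (r := 1 - β) (E := s₀.etheta) (D := τ + ‖η₀‖) (δ := δ)
      (c := 0.09 * τ) (by linarith) (by linarith) he0.le (by positivity) hδ0 (by positivity)
    have hb := hbound n
    have : (1 - β) ^ n * s₀.etheta * (1 + (τ + ‖η₀‖ + n * δ) ^ 2) < 0.09 * τ := by
      have e : τ + ‖η₀‖ + n * δ = (τ + ‖η₀‖) + n * δ := by ring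
      rw [e]; exact hn
    linarith

/-! ### E. Admissible starts exist in the model, so `IndepRunκ` is false there -/

/-- The diagonal intertwiner `D_A : v ↦ A(v₀ e₀ + τ v₁ e₁)` (`= V_y` for `y = A e₀` in the model: `V_y e₀ = y`,
`V_y e₁ = Ty`). [cite: Enflo2023, v2 (2)–(4) p.2] -/
def diagW (A τ : ℝ) : C2 →L[ℂ] C2 :=
  (A : ℂ) • ((EuclideanSpace.proj (0 : Fin 2) : C2 →L[ℂ] ℂ).smulRight e0 +
    (τ : ℂ) • (EuclideanSpace.proj (1 : Fin 2) : C2 →L[ℂ] ℂ).smulRight e1)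

/-- `(D_A v)₀ = A v₀`. [folklore] -/
@[simp] lemma diagW_apply_zero (A τ : ℝ) (v : C2) : (diagW A τ v) 0 = (A : ℂ) * v 0 := by
  simp [diagW]

/-- `(D_A v)₁ = A τ v₁`. [folklore] -/
@[simp] lemma diagW_apply_one (A τ : ℝ) (v : C2) : (diagW A τ v) 1 = (A : ℂ) * ((τ : ℂ) * v 1) := by
  simp [diagW]

/-- `D_A` intertwines: `D_A (J b) = τ J (D_A b)`. [folklore] -/
lemma diagW_intertwine (A τ : ℝ) (b : C2) : diagW A τ (J b) = (Tτ τ) (diagW A τ b) := by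
  ext i
  fin_cases i
  · simp [Tτ_apply]
  · simp [Tτ_apply]; ring

/-- adjoint of `D_A` in coordinates. [folklore] -/
lemma adjoint_diagW_zero (A τ : ℝ) (u : C2) : (adjoint (diagW A τ) u) 0 = (A : ℂ) * u 0 := by
  rw [adjoint_zero (W := diagW A τ), diagW_apply_zero, diagW_apply_one, e0_zero, e0_one, mul_one,
    mul_zero, mul_zero, map_zero, zero_mul, add_zero, Complex.conj_ofReal]

/-- `(D_A† u)₁ = A τ u₁`. [folklore] -/
lemma adjoint_diagW_one (A τ : ℝ) (u : C2) : (adjoint (diagW A τ) u) 1 = (A : ℂ) * (τ : ℂ) * u 1 := by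
  rw [adjoint_coord_one, inner_coord, diagW_apply_zero, diagW_apply_one, e1_zero, e1_one, mul_zero, map_zero,
    zero_mul, zero_add, mul_one, map_mul, Complex.conj_ofReal, Complex.conj_ofReal]

/-- the start vector `x₀ = (4/5)e₀ + (3/5)e₁` (unit). [cite: Enflo2023, v2 p.17] -/
def xSt : C2 := ((4 / 5 : ℝ) : ℂ) • e0 + ((3 / 5 : ℝ) : ℂ) • e1

/-- `(x₀)₀ = 4/5`. [folklore] -/
@[simp] lemma xSt_zero : xSt 0 = ((4 / 5 : ℝ) : ℂ) := by simp [xSt]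
/-- `(x₀)₁ = 3/5`. [folklore] -/
@[simp] lemma xSt_one : xSt 1 = ((3 / 5 : ℝ) : ℂ) := by simp [xSt]

/-- the start bracket point `z = ((4/5)τ/(1+τ), (3/5)/(1+τ))`. [cite: Enflo2023, v2 (15) p.6] -/
def zSt (τ : ℝ) : C2 := ((4 / 5 * τ / (1 + τ) : ℝ) : ℂ) • e0 + ((3 / 5 / (1 + τ) : ℝ) : ℂ) • e1

/-- `z₀`. [folklore] -/
@[simp] lemma zSt_zero (τ : ℝ) : zSt τ 0 = ((4 / 5 * τ / (1 + τ) : ℝ) : ℂ) := by simp [zSt]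
/-- `z₁`. [folklore] -/
@[simp] lemma zSt_one (τ : ℝ) : zSt τ 1 = ((3 / 5 / (1 + τ) : ℝ) : ℂ) := by simp [zSt]

/-- the start operator `W = τ^{-1/2}·diag(1, τ)` (`= V_y`, `y = τ^{-1/2} e₀`). [cite: Enflo2023, v2 (2) p.2] -/
def WSt (τ : ℝ) : C2 →L[ℂ] C2 := diagW (Real.sqrt (1 / τ)) τ

/-- the bracket point of the side vector `c = x₀ − z`: `u = [ ]⁻¹c = ((4/5)τ/(1+τ)², (3/5)τ/(1+τ)²)`.
[cite: Enflo2023, v2 (15) p.6] -/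
def uSt (τ : ℝ) : C2 :=
  ((4 / 5 * τ / (1 + τ) ^ 2 : ℝ) : ℂ) • e0 + ((3 / 5 * τ / (1 + τ) ^ 2 : ℝ) : ℂ) • e1

/-- `u₀`. [folklore] -/
@[simp] lemma uSt_zero (τ : ℝ) : uSt τ 0 = ((4 / 5 * τ / (1 + τ) ^ 2 : ℝ) : ℂ) := by simp [uSt]
/-- `u₁`. [folklore] -/
@[simp] lemma uSt_one (τ : ℝ) : uSt τ 1 = ((3 / 5 * τ / (1 + τ) ^ 2 : ℝ) : ℂ) := by simp [uSt]

/-- `√(1/τ)·√(1/τ) = 1/τ`. [folklore] -/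
lemma sqrt_inv_mul_self {τ : ℝ} (hτ : 0 < τ) : Real.sqrt (1 / τ) * Real.sqrt (1 / τ) = 1 / τ :=
  Real.mul_self_sqrt (by positivity)

/-- **bracket equation at the start**: `z + WW†z = x₀`. [cite: Enflo2023, v2 (15) p.6] -/
lemma isBracket_start {τ : ℝ} (hτ : 0 < τ) : IsBracket (WSt τ) xSt (zSt τ) := by
  have hAA := sqrt_inv_mul_self hτ
  set A : ℝ := Real.sqrt (1 / τ) with hAd
  have hne : (1 + τ) ≠ 0 := by positivity
  show zSt τ + WSt τ (adjoint (WSt τ) (zSt τ)) = xSt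
  ext i
  fin_cases i
  · show (zSt τ + WSt τ (adjoint (WSt τ) (zSt τ))) 0 = xSt 0
    rw [PiLp.add_apply, WSt, diagW_apply_zero, adjoint_diagW_zero, zSt_zero, xSt_zero]
    have e : 4 / 5 * τ / (1 + τ) + A * (A * (4 / 5 * τ / (1 + τ))) = 4 / 5 := by
      have h1 : A * (A * (4 / 5 * τ / (1 + τ))) = (A * A) * τ * (4 / 5) / (1 + τ) := by ring
      rw [h1, hAA, div_mul_cancel₀ _ hτ.ne']
      field_simp
      ring
    have e' := congrArg (fun r : ℝ => (r : ℂ)) e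
    push_cast at e' ⊢
    linear_combination e'
  · show (zSt τ + WSt τ (adjoint (WSt τ) (zSt τ))) 1 = xSt 1
    rw [PiLp.add_apply, WSt, diagW_apply_one, adjoint_diagW_one, zSt_one, xSt_one]
    have e : 3 / 5 / (1 + τ) + A * (τ * (A * τ * (3 / 5 / (1 + τ)))) = 3 / 5 := by
      have h1 : A * (τ * (A * τ * (3 / 5 / (1 + τ)))) = (τ * (A * A)) * (τ * (3 / 5 / (1 + τ))) := by ring
      rw [h1, hAA, mul_one_div_cancel hτ.ne', one_mul]
      calc 3 / 5 / (1 + τ) + τ * (3 / 5 / (1 + τ)) = 3 / 5 / (1 + τ) * (1 + τ) := by ring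
        _ = 3 / 5 := div_mul_cancel₀ _ hne
    have e' := congrArg (fun r : ℝ => (r : ℂ)) e
    push_cast at e' ⊢
    linear_combination e'

/-- **bracket equation of the side vector**: `u + WW†u = x₀ − z`. [cite: Enflo2023, v2 (15) p.6] -/
lemma isBracket_side {τ : ℝ} (hτ : 0 < τ) : IsBracket (WSt τ) (xSt - zSt τ) (uSt τ) := by
  have hAA := sqrt_inv_mul_self hτ
  set A : ℝ := Real.sqrt (1 / τ) with hAd
  have hne : (1 + τ) ≠ 0 := by positivity
  have hne2 : (1 + τ) ^ 2 ≠ 0 := by positivity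
  show uSt τ + WSt τ (adjoint (WSt τ) (uSt τ)) = xSt - zSt τ
  ext i
  fin_cases i
  · show (uSt τ + WSt τ (adjoint (WSt τ) (uSt τ))) 0 = (xSt - zSt τ) 0
    rw [PiLp.add_apply, PiLp.sub_apply, WSt, diagW_apply_zero, adjoint_diagW_zero, uSt_zero, xSt_zero, zSt_zero]
    have e : 4 / 5 * τ / (1 + τ) ^ 2 + A * (A * (4 / 5 * τ / (1 + τ) ^ 2)) = 4 / 5 - 4 / 5 * τ / (1 + τ) := by
      have h1 : A * (A * (4 / 5 * τ / (1 + τ) ^ 2)) = (A * A) * τ * (4 / 5) / (1 + τ) ^ 2 := by ring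
      rw [h1, hAA, div_mul_cancel₀ _ hτ.ne']
      field_simp
      ring
    have e' := congrArg (fun r : ℝ => (r : ℂ)) e
    push_cast at e' ⊢
    linear_combination e'
  · show (uSt τ + WSt τ (adjoint (WSt τ) (uSt τ))) 1 = (xSt - zSt τ) 1
    rw [PiLp.add_apply, PiLp.sub_apply, WSt, diagW_apply_one, adjoint_diagW_one, uSt_one, xSt_one, zSt_one]
    have e : 3 / 5 * τ / (1 + τ) ^ 2 + A * (τ * (A * τ * (3 / 5 * τ / (1 + τ) ^ 2))) =
        3 / 5 - 3 / 5 / (1 + τ) := by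
      have h1 : A * (τ * (A * τ * (3 / 5 * τ / (1 + τ) ^ 2))) =
          (τ * (A * A)) * (τ * (3 / 5 * τ / (1 + τ) ^ 2)) := by ring
      rw [h1, hAA, mul_one_div_cancel hτ.ne', one_mul]
      field_simp
      ring
    have e' := congrArg (fun r : ℝ => (r : ℂ)) e
    push_cast at e' ⊢
    linear_combination e'

/-- the pivot objects at the start: `[ ]⁻¹x₀ = z`, `ℓ = W†z`, `κ(x₀ − z) = W†u`. [cite: Enflo2023, v2 (35)–(36) p.16] -/
lemma start_pivot {τ : ℝ} (hτ : 0 < τ) :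
    bz (WSt τ) xSt = zSt τ ∧ ba (WSt τ) xSt = adjoint (WSt τ) (zSt τ) ∧
      bκ (WSt τ) (xSt - zSt τ) = adjoint (WSt τ) (uSt τ) := by
  have h1 : bz (WSt τ) xSt = zSt τ := brInv_eq_of_isBracket (isBracket_start hτ)
  refine ⟨h1, by rw [ba, h1], ?_⟩
  show adjoint (WSt τ) (brInv (WSt τ) (xSt - zSt τ)) = _
  rw [brInv_eq_of_isBracket (isBracket_side hτ)]

/-- the real inequality behind the necessary condition: `25c² ≤ 4(16|c − w|² + 9|c − τw|²)`. [folklore] -/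
lemma nec_ineq {τ c a b : ℝ} (hτ : 0 ≤ τ) (hτ1 : τ ≤ 1 / 250) :
    16 * c ^ 2 + 9 * c ^ 2 ≤
      4 * (16 * ((c - a) ^ 2 + b ^ 2) + 9 * ((c - τ * a) ^ 2 + (τ * b) ^ 2)) := by
  nlinarith [sq_nonneg (4 * (a - c) - 9 / 4 * τ * c), sq_nonneg b, sq_nonneg (τ * b), sq_nonneg (c - τ * a),
    mul_nonneg (mul_nonneg hτ hτ) (sq_nonneg c), mul_nonneg hτ (sq_nonneg c),
    mul_nonneg (sub_nonneg.2 hτ1) (sq_nonneg c)]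

/-- **At the start the STATE-LEVEL necessary condition of gen 12 holds with the best modulus `σ = 1`**:
`‖ℓ‖ ≤ 2‖ℓ − μκ(x₀ − z)‖` for every `μ ∈ ℂ` (the conclusion of `indepBrκ_self_le` with `σ = 1`; here
`ℓ ∝ (4, 3)`, `κ ∝ (4, 3τ)`), although the run from this start refutes `IndepRunκ` (`not_indepRunκ`).
[cite: Enflo2023, v2 (34)–(36) p.16] -/
theorem start_necessary_condition {τ : ℝ} (hτ : 0 < τ) (hτ1 : τ ≤ 1 / 250) (μ : ℂ) :
    ‖ba (WSt τ) xSt‖ ≤ 2 * ‖ba (WSt τ) xSt - μ • bκ (WSt τ) (xSt - bz (WSt τ) xSt)‖ := by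
  obtain ⟨hbz, hba, hbκ⟩ := start_pivot hτ
  rw [hba, hbz, hbκ]
  have hA0 : 0 < Real.sqrt (1 / τ) := Real.sqrt_pos.2 (by positivity)
  -- `ℓ = C·(4,3)`, `κ = D·(4,3τ)` with `C = τ^{1/2}/(5(1+τ))`, `D = C/(1+τ)`
  set C : ℝ := Real.sqrt (1 / τ) * τ / (5 * (1 + τ)) with hCd
  set D : ℝ := Real.sqrt (1 / τ) * τ / (5 * (1 + τ) ^ 2) with hDd
  have hC0 : 0 ≤ C := by positivity
  have hne : (1 + (τ : ℂ)) ≠ 0 := by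
    have h : (0 : ℝ) < 1 + τ := by positivity
    exact_mod_cast h.ne'
  have hℓ0 : (adjoint (WSt τ) (zSt τ)) 0 = ((4 : ℝ) : ℂ) * (C : ℂ) := by
    rw [WSt, adjoint_diagW_zero, zSt_zero, hCd]; push_cast; field_simp
  have hℓ1 : (adjoint (WSt τ) (zSt τ)) 1 = ((3 : ℝ) : ℂ) * (C : ℂ) := by
    rw [WSt, adjoint_diagW_one, zSt_one, hCd]; push_cast; field_simp
  have hκ0 : (adjoint (WSt τ) (uSt τ)) 0 = ((4 : ℝ) : ℂ) * (D : ℂ) := by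
    rw [WSt, adjoint_diagW_zero, uSt_zero, hDd]; push_cast; field_simp
  have hκ1 : (adjoint (WSt τ) (uSt τ)) 1 = ((3 : ℝ) : ℂ) * ((τ : ℂ) * (D : ℂ)) := by
    rw [WSt, adjoint_diagW_one, uSt_one, hDd]; push_cast; field_simp
  set w : ℂ := μ * (D : ℂ) with hwd
  have hnℓ : ‖adjoint (WSt τ) (zSt τ)‖ ^ 2 = 16 * C ^ 2 + 9 * C ^ 2 := by
    rw [norm_sq, hℓ0, hℓ1, norm_mul, norm_mul, Complex.norm_of_nonneg (by norm_num : (0:ℝ) ≤ 4),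
      Complex.norm_of_nonneg (by norm_num : (0:ℝ) ≤ 3), Complex.norm_of_nonneg hC0]
    ring
  have hd0 : (adjoint (WSt τ) (zSt τ) - μ • adjoint (WSt τ) (uSt τ)) 0 = ((4 : ℝ) : ℂ) * ((C : ℂ) - w) := by
    rw [PiLp.sub_apply, PiLp.smul_apply, hℓ0, hκ0, smul_eq_mul, hwd]; ring
  have hd1 : (adjoint (WSt τ) (zSt τ) - μ • adjoint (WSt τ) (uSt τ)) 1 =
      ((3 : ℝ) : ℂ) * ((C : ℂ) - (τ : ℂ) * w) := by
    rw [PiLp.sub_apply, PiLp.smul_apply, hℓ1, hκ1, smul_eq_mul, hwd]; ring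
  have hsq : ∀ v : ℂ, ‖v‖ ^ 2 = v.re ^ 2 + v.im ^ 2 := fun v => by
    rw [Complex.sq_norm, Complex.normSq_apply]; ring
  have hre1 : ((C : ℂ) - w).re = C - w.re := by simp
  have him1 : ((C : ℂ) - w).im = -w.im := by simp
  have hre2 : ((C : ℂ) - (τ : ℂ) * w).re = C - τ * w.re := by simp
  have him2 : ((C : ℂ) - (τ : ℂ) * w).im = -(τ * w.im) := by simp
  have hnd : ‖adjoint (WSt τ) (zSt τ) - μ • adjoint (WSt τ) (uSt τ)‖ ^ 2 =
      16 * ((C - w.re) ^ 2 + w.im ^ 2) + 9 * ((C - τ * w.re) ^ 2 + (τ * w.im) ^ 2) := by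
    rw [norm_sq, hd0, hd1, norm_mul, norm_mul, Complex.norm_of_nonneg (by norm_num : (0:ℝ) ≤ 4),
      Complex.norm_of_nonneg (by norm_num : (0:ℝ) ≤ 3), mul_pow, mul_pow, hsq ((C : ℂ) - w),
      hsq ((C : ℂ) - (τ : ℂ) * w), hre1, him1, hre2, him2]
    ring
  have key : ‖adjoint (WSt τ) (zSt τ)‖ ^ 2 ≤
      (2 * ‖adjoint (WSt τ) (zSt τ) - μ • adjoint (WSt τ) (uSt τ)‖) ^ 2 := by
    rw [mul_pow, hnℓ, hnd]
    have := nec_ineq (c := C) (a := w.re) (b := w.im) hτ.le hτ1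
    linarith
  exact (pow_le_pow_iff_left₀ (norm_nonneg _) (by positivity) two_ne_zero).1 key

/-- `‖x₀‖ = 1`. [folklore] -/
lemma norm_xSt : ‖xSt‖ = 1 := by
  have h : ‖xSt‖ ^ 2 = 1 := by
    rw [norm_sq, xSt_zero, xSt_one, Complex.norm_of_nonneg (by norm_num), Complex.norm_of_nonneg (by norm_num)]
    norm_num
  exact (pow_eq_one_iff_of_nonneg (norm_nonneg xSt) two_ne_zero).1 h

/-- **The admissible start, concretely**: for `0 < τ ≤ σ/250`, `0 < σ ≤ 1`, over `x₀ = (4/5, 3/5)` the operator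
`W = τ^{-1/2}·diag(1, τ)` is a TRUE MC state over `J` (it intertwines, its bracket point `z` has
`ε = ‖z‖ ∈ [0.3, 0.7]` and `ℓ = W†z` is the minimiser) with `0 < (εθ)₀ = ‖ℓ‖² ≤ τ` and the run's start margin
`0.09 + (22/σ + 1)(εθ)₀ ≤ ε₀² ≤ 0.49 − (22/σ + 1)(εθ)₀`. [cite: Enflo2023, v2 (2) p.2, (15) p.6, p.17] -/
theorem exists_start_at {τ σ : ℝ} (hτ : 0 < τ) (hσ : 0 < σ) (hσ1 : σ ≤ 1) (hτσ : τ ≤ σ / 250) :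
    ∃ s₀ : State (Tτ τ) xSt J, s₀.V = WSt τ ∧ 0 < s₀.etheta ∧ s₀.etheta ≤ τ ∧
      ((0.09 : ℝ) + (22 / σ + 1) * s₀.etheta ≤ s₀.ε ^ 2 ∧ s₀.ε ^ 2 + (22 / σ + 1) * s₀.etheta ≤ 0.49) := by
  have hτ1 : τ ≤ 1 / 250 := by linarith
  have hAA := sqrt_inv_mul_self hτ
  have hA0 : 0 < Real.sqrt (1 / τ) := Real.sqrt_pos.2 (by positivity)
  set A : ℝ := Real.sqrt (1 / τ) with hAd
  set z0 : ℝ := 4 / 5 * τ / (1 + τ) with hz0d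
  set z1 : ℝ := 3 / 5 / (1 + τ) with hz1d
  have hzz0 : zSt τ 0 = (z0 : ℂ) := zSt_zero τ
  have hzz1 : zSt τ 1 = (z1 : ℂ) := zSt_one τ
  have hz00 : 0 ≤ z0 := by positivity
  have hz10 : 0 ≤ z1 := by positivity
  have hbr : IsBracket (WSt τ) xSt (zSt τ) := isBracket_start hτ
  -- `ℓ = W†z` in coordinates
  have hℓ0 : (adjoint (WSt τ) (zSt τ)) 0 = (A : ℂ) * (z0 : ℂ) := by
    rw [WSt, adjoint_diagW_zero, hzz0]
  have hℓ1 : (adjoint (WSt τ) (zSt τ)) 1 = (A : ℂ) * (τ : ℂ) * (z1 : ℂ) := by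
    rw [WSt, adjoint_diagW_one, hzz1]
  -- norms
  have hττ : 0 < τ * τ := mul_pos hτ hτ
  have hz1lo : (0.55 : ℝ) ≤ z1 := by
    rw [hz1d, le_div_iff₀ (by positivity)]; linarith
  have hz1hi : z1 ≤ 3 / 5 := by
    rw [hz1d, div_le_iff₀ (by positivity)]; linarith
  have hz0hi' : z0 ≤ 4 / 5 * τ := by
    rw [hz0d, div_le_iff₀ (by positivity)]; linarith
  have hz0hi : z0 ≤ τ := by linarith
  have hnz : ‖zSt τ‖ ^ 2 = z0 ^ 2 + z1 ^ 2 := by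
    rw [norm_sq, hzz0, hzz1, Complex.norm_of_nonneg hz00, Complex.norm_of_nonneg hz10]
  have hzlo : (0.3 : ℝ) ≤ ‖zSt τ‖ ^ 2 := by
    have h1 := pow_le_pow_left₀ (by norm_num) hz1lo 2
    have h2 := sq_nonneg z0
    rw [hnz]; norm_num at h1 ⊢; linarith
  have hzhi : ‖zSt τ‖ ^ 2 ≤ 0.37 := by
    have h1 := pow_le_pow_left₀ hz10 hz1hi 2
    have h2 := pow_le_pow_left₀ hz00 hz0hi 2
    have h3 := pow_le_pow_left₀ hτ.le hτ1 2
    rw [hnz]; norm_num at h1 h2 h3 ⊢; linarith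
  have hzz : ‖zSt τ‖ ^ 2 = ‖zSt τ‖ * ‖zSt τ‖ := sq ‖zSt τ‖
  have hwin : (0.3 : ℝ) ≤ ‖zSt τ‖ ∧ ‖zSt τ‖ ≤ 0.7 := by
    constructor
    · by_contra hc
      have h' := mul_self_lt_mul_self (norm_nonneg _) (lt_of_not_ge hc)
      rw [← hzz] at h'
      norm_num at h'
      linarith
    · by_contra hc
      have h' := mul_self_lt_mul_self (by norm_num) (lt_of_not_ge hc)
      rw [← hzz] at h'
      norm_num at h'
      linarith
  -- (εθ) = ‖W†z‖² = A² z0² + A²τ² z1² = z0²/τ + τ z1²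
  have heth : ‖adjoint (WSt τ) (zSt τ)‖ ^ 2 = z0 ^ 2 / τ + τ * z1 ^ 2 := by
    rw [norm_sq, hℓ0, hℓ1, norm_mul, norm_mul, norm_mul, Complex.norm_of_nonneg hA0.le,
      Complex.norm_of_nonneg hz00, Complex.norm_of_nonneg hτ.le, Complex.norm_of_nonneg hz10]
    have e1 : (A * z0) ^ 2 = (A * A) * z0 ^ 2 := by ring
    have e2 : (A * τ * z1) ^ 2 = τ * (τ * (A * A)) * z1 ^ 2 := by ring
    rw [e1, e2, hAA, mul_one_div_cancel hτ.ne']; ring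
  have heth_pos : 0 < z0 ^ 2 / τ + τ * z1 ^ 2 := by
    have h1 : 0 < τ * z1 ^ 2 := by positivity
    have h2 : 0 ≤ z0 ^ 2 / τ := by positivity
    linarith
  have heth_le : z0 ^ 2 / τ + τ * z1 ^ 2 ≤ τ := by
    have h1 : z0 ^ 2 / τ ≤ (16 / 25) * τ := by
      rw [div_le_iff₀ hτ]
      have h := pow_le_pow_left₀ hz00 hz0hi' 2
      have e : (4 / 5 * τ) ^ 2 = 16 / 25 * τ * τ := by ring
      linarith [h, e]
    have h2 : τ * z1 ^ 2 ≤ τ * (9 / 25) := by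
      apply mul_le_mul_of_nonneg_left _ hτ.le
      have h := pow_le_pow_left₀ hz10 hz1hi 2
      norm_num at h ⊢; exact h
    linarith
  -- the state
  let s₀ : State (Tτ τ) xSt J :=
    ⟨WSt τ, fun b => diagW_intertwine _ τ b, ‖zSt τ‖, hwin, _, hbr.isMinimal⟩
  have hv : s₀.v = zSt τ := hbr.sub_eq
  have he : s₀.etheta = z0 ^ 2 / τ + τ * z1 ^ 2 := by
    rw [etheta_eq_eth, hv, eth_eq_of_isBracket hbr, heth]
  have hε : s₀.ε = ‖zSt τ‖ := rfl
  have hm : (22 / σ + 1) * s₀.etheta ≤ 0.092 := by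
    rw [he]
    have h1 : (22 / σ + 1) * (z0 ^ 2 / τ + τ * z1 ^ 2) ≤ (22 / σ + 1) * τ :=
      mul_le_mul_of_nonneg_left heth_le (by positivity)
    have h2 : 22 / σ * τ ≤ 22 / 250 := by
      rw [div_mul_eq_mul_div, div_le_iff₀ hσ]; linarith
    have e : (22 / σ + 1) * τ = 22 / σ * τ + τ := by ring
    linarith
  refine ⟨s₀, rfl, by rw [he]; exact heth_pos, by rw [he]; exact heth_le, ?_, ?_⟩
  · rw [hε]; linarith
  · rw [hε]; linarith

/-- **Admissible starts exist**: for `0 < τ ≤ σ/250`, `0 < σ ≤ 1`, the unit vector `x₀ = (4/5, 3/5)` and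
the TRUE MC state `W = τ^{-1/2}·diag(1, τ)` (a `V_y`, `y = τ^{-1/2} e₀`; bracket point
`z = ((4/5)τ/(1+τ), (3/5)/(1+τ))`, `ε = ‖z‖ ∈ [0.3, 0.7]`, `ℓ = W†z`) have `0 < (εθ)₀ ≤ τ` and satisfy
the run's start margin `0.09 + (22/σ + 1)(εθ)₀ ≤ ε₀² ≤ 0.49 − (22/σ + 1)(εθ)₀`.
[cite: Enflo2023, v2 (2) p.2, (15) p.6, p.17 (window of ε)] -/
theorem exists_start {τ σ : ℝ} (hτ : 0 < τ) (hσ : 0 < σ) (hσ1 : σ ≤ 1) (hτσ : τ ≤ σ / 250) :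
    ∃ (x₀ : C2) (s₀ : State (Tτ τ) x₀ J), ‖x₀‖ = 1 ∧ 0 < s₀.etheta ∧ s₀.etheta ≤ τ ∧
      ((0.09 : ℝ) + (22 / σ + 1) * s₀.etheta ≤ s₀.ε ^ 2 ∧ s₀.ε ^ 2 + (22 / σ + 1) * s₀.etheta ≤ 0.49) := by
  obtain ⟨s₀, -, h0, hle, hm⟩ := exists_start_at hτ hσ hσ1 hτσ
  exact ⟨xSt, s₀, norm_xSt, h0, hle, hm⟩

/-- **`IndepRunκ` IS FALSE IN THE MODEL**: for `0 < τ ≤ σ/250`, `0 < σ ≤ 1`, `0 < β ≤ σ²/1000` there is an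
admissible start (unit `x₀`, true MC state `s₀` over `J` with the start margin and `(εθ)₀ > 0`) at which the
run-level intrinsic independence hypothesis fails. [cite: Enflo2023, v2 (34) p.16; p.19–20] -/
theorem not_indepRunκ {τ σ β : ℝ} (hτ : 0 < τ) (hσ : 0 < σ) (hσ1 : σ ≤ 1) (hτσ : τ ≤ σ / 250)
    (hβ0 : 0 < β) (hβ : β ≤ σ ^ 2 / 1000) :
    ∃ (x₀ : C2) (s₀ : State (Tτ τ) x₀ J), ‖x₀‖ = 1 ∧ 0 < s₀.etheta ∧
      ((0.09 : ℝ) + (22 / σ + 1) * s₀.etheta ≤ s₀.ε ^ 2 ∧ s₀.ε ^ 2 + (22 / σ + 1) * s₀.etheta ≤ 0.49) ∧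
      ¬ IndepRunκ (Tτ τ) x₀ J (ιS J) σ β s₀ := by
  obtain ⟨x₀, s₀, hx₀, he, -, hstart⟩ := exists_start hτ hσ hσ1 hτσ
  exact ⟨x₀, s₀, hx₀, he, hstart, fun h => he.ne' (indepRunκ_etheta_eq_zero hτ hx₀ hσ hσ1 hβ0 hβ s₀ hstart h)⟩

/-- **The contrast in one statement**: at the concrete admissible start (`x₀ = (4/5, 3/5)`,
`W = τ^{-1/2}·diag(1, τ)`) the STATE-LEVEL necessary condition of gen 12 (`indepBrκ_self_le`) holds for
every `μ ∈ ℂ` even with `σ = 1`, and yet the RUN-LEVEL hypothesis `IndepRunκ` fails from that start: the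
obstruction is the deterministic drift of `ℓ` along the run (direction freezing), not the position of `ℓ`
against `κ` at any one state. [cite: Enflo2023, v2 (34)–(36) p.16; p.19–20] -/
theorem not_indepRunκ_at {τ σ β : ℝ} (hτ : 0 < τ) (hσ : 0 < σ) (hσ1 : σ ≤ 1) (hτσ : τ ≤ σ / 250)
    (hβ0 : 0 < β) (hβ : β ≤ σ ^ 2 / 1000) :
    ∃ s₀ : State (Tτ τ) xSt J, 0 < s₀.etheta ∧
      ((0.09 : ℝ) + (22 / σ + 1) * s₀.etheta ≤ s₀.ε ^ 2 ∧ s₀.ε ^ 2 + (22 / σ + 1) * s₀.etheta ≤ 0.49) ∧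
      (∀ μ : ℂ, ‖ba s₀.V xSt‖ ≤ 2 * ‖ba s₀.V xSt - μ • bκ s₀.V (xSt - bz s₀.V xSt)‖) ∧
      ¬ IndepRunκ (Tτ τ) xSt J (ιS J) σ β s₀ := by
  have hτ1 : τ ≤ 1 / 250 := by linarith
  obtain ⟨s₀, hV, he, -, hstart⟩ := exists_start_at hτ hσ hσ1 hτσ
  refine ⟨s₀, he, hstart, fun μ => ?_,
    fun h => he.ne' (indepRunκ_etheta_eq_zero hτ norm_xSt hσ hσ1 hβ0 hβ s₀ hstart h)⟩
  rw [hV]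
  exact start_necessary_condition hτ hτ1 μ

/-! ### E'. The model operator itself: nilpotent, of type 2 and not of type 1, with invariant subspaces
(so the theorems above contradict no assertion of the text, which argues on the type-1 branch for an operator
without invariant subspaces) -/

/-- `T_τ(T_τ w) = 0` (`T_τ² = 0`). [folklore] -/
lemma Tτ_Tτ (τ : ℝ) (w : C2) : Tτ τ (Tτ τ w) = 0 := by
  rw [Tτ_apply, Tτ_apply, map_smul, J_apply (J w), J_apply_zero, zero_smul, smul_zero, smul_zero]

/-- all iterates from the second on vanish. [folklore] -/
lemma Tτ_iterate (τ : ℝ) (k : ℕ) (w : C2) : (⇑(Tτ τ))^[k + 2] w = 0 := by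
  rw [show k + 2 = (k + 1).succ from rfl, Function.iterate_succ_apply', Function.iterate_succ_apply', Tτ_Tτ]

/-- a unit vector satisfies the paper's angular condition with itself. [cite: Enflo2023, v2 p.6] -/
lemma angleCond_self {u : C2} (hu : ‖u‖ = 1) : Referee.AngleCond u u := by
  refine ⟨fun h0 => by simp [h0] at hu, ?_⟩
  have h := inner_self_eq_norm_sq (𝕜 := ℂ) u
  rw [RCLike.re_to_complex] at h
  rw [h, hu]
  norm_num

/-- **The model operator is NOT of type 1** (v2 p.6): with `n = 2` every `⟨T^j y, y⟩`, `j ≥ 2`, vanishes.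
[cite: Enflo2023, v2 p.6 (19)] -/
theorem not_type1 (τ : ℝ) : ¬ Referee.Type1 (Tτ τ) := by
  rintro ⟨u0, hu0, h⟩
  obtain ⟨δ, hδ, hy⟩ := h 2 (by norm_num)
  obtain ⟨j, hj, hjδ⟩ := hy u0 (angleCond_self hu0)
  obtain ⟨k, rfl⟩ := Nat.exists_eq_add_of_le hj
  rw [add_comm, Tτ_iterate, inner_zero_left, norm_zero, hu0, one_pow, mul_one] at hjδ
  exact absurd hjδ (not_le.2 hδ)

/-- **The model operator IS of type 2** (v2 p.7): `m = 2`, `y = u₀`. [cite: Enflo2023, v2 p.7] -/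
theorem type2 (τ : ℝ) : Referee.Type2 (Tτ τ) := by
  intro u0 hu0
  refine ⟨2, by norm_num, fun δ hδ => ⟨u0, angleCond_self hu0, fun j hj => ?_⟩⟩
  obtain ⟨k, rfl⟩ := Nat.exists_eq_add_of_le hj
  rw [add_comm, Tτ_iterate, inner_zero_left, norm_zero]
  positivity

/-- **The model operator HAS a non-trivial closed invariant subspace** (`ℂe₁ = ker T_τ ⊇ range T_τ`; the orbit
of `e₁` is orthogonal to `e₀`). [folklore] -/
theorem hasNontrivialClosedInvariantSubspace (τ : ℝ) : HasNontrivialClosedInvariantSubspace (Tτ τ) := by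
  have he1 : e1 ≠ 0 := fun h => by simpa [h] using norm_e1
  have he0 : e0 ≠ 0 := fun h => by simpa [h] using norm_e0
  refine hasNontrivialClosedInvariantSubspace_of_orbit_orthogonal (Tτ τ) he1 he0 fun j => ?_
  cases j with
  | zero => rw [pow_zero, one_apply_eq_self, inner_e1_left, e0_one]
  | succ k =>
    rw [pow_succ]
    show ⟪(Tτ τ ^ k) (Tτ τ e1), e0⟫_ℂ = 0
    rw [Tτ_apply, J_e1, smul_zero, map_zero, inner_zero_left]

end Toy

/-! ### F. The dimension-free half: direction freezing of the admissible steps in the `ℓ²`-model `V_y` -/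

/-- **DIRECTION FREEZE (any `T`, `‖T‖ < 1`, any step direction `N` on `ℓ²`).**  The new direction vector after the
step `V_y ↦ V_y ∘ (1 + N)` is `V_y((1+N)e₀) = (1 + (Ne₀)₀)·y + t` with
`‖t‖ ≤ ‖T‖ · ‖y‖(1 − ‖T‖²)^{-1/2} · ‖N‖`: per admissible step (`‖N‖ ≤ 2β/σ`) the direction of `y_n` turns by
`O(‖T‖β/σ)` — `O(10⁻²⁰β/σ)` in the text — while `(εθ)` drops by the factor `1 − β`.  (The text's directions
`y ↦ y + r(T)y`, `r` a polynomial, are the case `N =` multiplication by `r` on `ℓ²`.) [cite: Enflo2023, v2 p.16 ("`T^j(y' + r(T)y')`"); pp.8–13 (tail bound)] -/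
theorem direction_freeze {H : Type*} [NormedAddCommGroup H] [InnerProductSpace ℂ H] [CompleteSpace H]
    (T : H →L[ℂ] H) (hT : ‖T‖ < 1) (y : H) (N : Vy.ℓ2 →L[ℂ] Vy.ℓ2) :
    ‖(Vy.V T hT y ∘L (1 + N)) (lp.single 2 0 (1 : ℂ)) - (1 + N (lp.single 2 0 (1 : ℂ)) 0) • y‖ ≤
      ‖T‖ * (‖y‖ * Real.sqrt (1 / (1 - ‖T‖ ^ 2))) * ‖N‖ := by
  set e : Vy.ℓ2 := lp.single 2 0 (1 : ℂ) with hed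
  have he : ‖e‖ = 1 := by rw [hed, lp.norm_single (by norm_num)]; simp
  have h0 : Vy.V T hT y e = y := by rw [hed, Vy.V_single, pow_zero, one_apply_eq_self]
  have hsplit : (Vy.V T hT y ∘L (1 + N)) e - (1 + N e 0) • y = Vy.V T hT y (N e) - (N e) 0 • y := by
    rw [comp_apply, add_apply, one_apply_eq_self, map_add, h0, add_smul, one_smul]
    abel
  rw [hsplit]
  have h1 := Vy.norm_V_sub_head_le T hT y (N e)
  have h2 : ‖Vy.L (N e)‖ ≤ ‖N‖ :=
    (Vy.norm_L_apply_le _).trans ((N.le_opNorm e).trans (by rw [he, mul_one]))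
  have h3 : 0 ≤ ‖T‖ * (‖y‖ * Real.sqrt (1 / (1 - ‖T‖ ^ 2))) := by positivity
  exact h1.trans (mul_le_mul_of_nonneg_left h2 h3)

end StepRealisation

end Literature.Analysis.OperatorTheory.Enflo2023

end
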